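import Summits.Ventures.PercRepro.Night2GeneralQPoly

/-!
# PercRepro — the polynomial target-sum inequality `PolyIneq q n` of the regime `(q − 1, q − 3)` for `20 ≤ n ≤ 32`
(night-2, gen 21)

For each `n` the inequality `2 ((q³ + 2q² + 9q + 12) − (2q + 3) n) C(n, 4) ≤ 2 (2q + 3)(n + q − 4) A(n) + q (q + 1)² (n + q − 4)(n + 1)`
is proved for every `q ≥ 4` in three ranges: for small `q` the `A`-term alone carries the left side (a concave
cubic in `q`, certified by `(q − 4)(Q_A − q)(2 C q + β) ≥ 0` and its chord), for large `q` the `T`-term alone does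
(the Horner chain `q⁴ ≥ Q_T q³ ≥ Q_T² q² ≥ …`), and the finitely many `q` in between are evaluated in the kernel
(`A(n)` and `C(n, 4)` as numerals, `decide`).  Constants and ranges from `mining/night-2/g21/regions21b.py`.
-/

namespace PercRepro.Shadow

open Finset PerFlat ThmH

/-- `PolyIneq q 20` for every `q ≥ 4` (`A(20) = 1042359`, `C(20, 4) = 4845`; `A`-term alone for `q ≤ 445`, `T`-term alone for `q ≥ 446`). -/
theorem polyIneq_twenty {q : ℕ} (hq : 4 ≤ q) : PolyIneq q 20 := by
  have hA : DGen.Aρt 20 4 2 = 1042359 := by decide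
  have hC : Nat.choose 20 4 = 4845 := by decide
  unfold PolyIneq
  rw [hA, hC]
  push_cast
  have hx4 : (4 : ℚ) ≤ (q : ℚ) := by exact_mod_cast hq
  have hnq : (0 : ℚ) ≤ 20 + (q : ℚ) - 4 := by linarith
  have hT : (0 : ℚ) ≤ (q : ℚ) * ((q : ℚ) + 1) ^ 2 * (20 + (q : ℚ) - 4) * (20 + 1) :=
    mul_nonneg (mul_nonneg (by positivity) hnq) (by norm_num)
  have hAt : (0 : ℚ) ≤ 2 * (2 * (q : ℚ) + 3) * (20 + (q : ℚ) - 4) * 1042359 :=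
    mul_nonneg (mul_nonneg (by linarith) hnq) (by norm_num)
  rcases le_or_gt q 445 with hle | hlt
  · have hQ : (q : ℚ) ≤ 445 := by exact_mod_cast hle
    have hlin : (0 : ℚ) ≤ 2 * 4845 * (q : ℚ) + 200754 := by linarith
    nlinarith [mul_nonneg (mul_nonneg (sub_nonneg.2 hx4) (sub_nonneg.2 hQ)) hlin, hT, hx4, hQ]
  · have hQ : (446 : ℚ) ≤ (q : ℚ) := by exact_mod_cast (by omega : 446 ≤ q)
    have h1 : (446 : ℚ) * (q : ℚ) ≤ (q : ℚ) ^ 2 := by nlinarith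
    have h2 : (446 : ℚ) * (q : ℚ) ^ 2 ≤ (q : ℚ) ^ 3 := by nlinarith
    have h3 : (446 : ℚ) * (q : ℚ) ^ 3 ≤ (q : ℚ) ^ 4 := by nlinarith
    nlinarith [h1, h2, h3, hAt, hQ]

/-- `PolyIneq q 21` for every `q ≥ 4` (`A(21) = 2089583`, `C(21, 4) = 5985`; `A`-term alone for `q ≤ 714`, `T`-term alone for `q ≥ 528`). -/
theorem polyIneq_twentyone {q : ℕ} (hq : 4 ≤ q) : PolyIneq q 21 := by
  have hA : DGen.Aρt 21 4 2 = 2089583 := by decide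
  have hC : Nat.choose 21 4 = 5985 := by decide
  unfold PolyIneq
  rw [hA, hC]
  push_cast
  have hx4 : (4 : ℚ) ≤ (q : ℚ) := by exact_mod_cast hq
  have hnq : (0 : ℚ) ≤ 21 + (q : ℚ) - 4 := by linarith
  have hT : (0 : ℚ) ≤ (q : ℚ) * ((q : ℚ) + 1) ^ 2 * (21 + (q : ℚ) - 4) * (21 + 1) :=
    mul_nonneg (mul_nonneg (by positivity) hnq) (by norm_num)
  have hAt : (0 : ℚ) ≤ 2 * (2 * (q : ℚ) + 3) * (21 + (q : ℚ) - 4) * 2089583 :=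
    mul_nonneg (mul_nonneg (by linarith) hnq) (by norm_num)
  rcases le_or_gt q 714 with hle | hlt
  · have hQ : (q : ℚ) ≤ 714 := by exact_mod_cast hle
    have hlin : (0 : ℚ) ≤ 2 * 5985 * (q : ℚ) + 260068 := by linarith
    nlinarith [mul_nonneg (mul_nonneg (sub_nonneg.2 hx4) (sub_nonneg.2 hQ)) hlin, hT, hx4, hQ]
  · have hQ : (528 : ℚ) ≤ (q : ℚ) := by exact_mod_cast (by omega : 528 ≤ q)
    have h1 : (528 : ℚ) * (q : ℚ) ≤ (q : ℚ) ^ 2 := by nlinarith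
    have h2 : (528 : ℚ) * (q : ℚ) ^ 2 ≤ (q : ℚ) ^ 3 := by nlinarith
    have h3 : (528 : ℚ) * (q : ℚ) ^ 3 ≤ (q : ℚ) ^ 4 := by nlinarith
    nlinarith [h1, h2, h3, hAt, hQ]

/-- `PolyIneq q 22` for every `q ≥ 4` (`A(22) = 4185172`, `C(22, 4) = 7315`; `A`-term alone for `q ≤ 1161`, `T`-term alone for `q ≥ 619`). -/
theorem polyIneq_twentytwo {q : ℕ} (hq : 4 ≤ q) : PolyIneq q 22 := by
  have hA : DGen.Aρt 22 4 2 = 4185172 := by decide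
  have hC : Nat.choose 22 4 = 7315 := by decide
  unfold PolyIneq
  rw [hA, hC]
  push_cast
  have hx4 : (4 : ℚ) ≤ (q : ℚ) := by exact_mod_cast hq
  have hnq : (0 : ℚ) ≤ 22 + (q : ℚ) - 4 := by linarith
  have hT : (0 : ℚ) ≤ (q : ℚ) * ((q : ℚ) + 1) ^ 2 * (22 + (q : ℚ) - 4) * (22 + 1) :=
    mul_nonneg (mul_nonneg (by positivity) hnq) (by norm_num)
  have hAt : (0 : ℚ) ≤ 2 * (2 * (q : ℚ) + 3) * (22 + (q : ℚ) - 4) * 4185172 :=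
    mul_nonneg (mul_nonneg (by linarith) hnq) (by norm_num)
  rcases le_or_gt q 1161 with hle | hlt
  · have hQ : (q : ℚ) ≤ 1161 := by exact_mod_cast hle
    have hlin : (0 : ℚ) ≤ 2 * 7315 * (q : ℚ) + 332522 := by linarith
    nlinarith [mul_nonneg (mul_nonneg (sub_nonneg.2 hx4) (sub_nonneg.2 hQ)) hlin, hT, hx4, hQ]
  · have hQ : (619 : ℚ) ≤ (q : ℚ) := by exact_mod_cast (by omega : 619 ≤ q)
    have h1 : (619 : ℚ) * (q : ℚ) ≤ (q : ℚ) ^ 2 := by nlinarith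
    have h2 : (619 : ℚ) * (q : ℚ) ^ 2 ≤ (q : ℚ) ^ 3 := by nlinarith
    have h3 : (619 : ℚ) * (q : ℚ) ^ 3 ≤ (q : ℚ) ^ 4 := by nlinarith
    nlinarith [h1, h2, h3, hAt, hQ]

/-- `PolyIneq q 23` for every `q ≥ 4` (`A(23) = 8377681`, `C(23, 4) = 8855`; `A`-term alone for `q ≤ 1910`, `T`-term alone for `q ≥ 719`). -/
theorem polyIneq_twentythree {q : ℕ} (hq : 4 ≤ q) : PolyIneq q 23 := by
  have hA : DGen.Aρt 23 4 2 = 8377681 := by decide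
  have hC : Nat.choose 23 4 = 8855 := by decide
  unfold PolyIneq
  rw [hA, hC]
  push_cast
  have hx4 : (4 : ℚ) ≤ (q : ℚ) := by exact_mod_cast hq
  have hnq : (0 : ℚ) ≤ 23 + (q : ℚ) - 4 := by linarith
  have hT : (0 : ℚ) ≤ (q : ℚ) * ((q : ℚ) + 1) ^ 2 * (23 + (q : ℚ) - 4) * (23 + 1) :=
    mul_nonneg (mul_nonneg (by positivity) hnq) (by norm_num)
  have hAt : (0 : ℚ) ≤ 2 * (2 * (q : ℚ) + 3) * (23 + (q : ℚ) - 4) * 8377681 :=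
    mul_nonneg (mul_nonneg (by linarith) hnq) (by norm_num)
  rcases le_or_gt q 1910 with hle | hlt
  · have hQ : (q : ℚ) ≤ 1910 := by exact_mod_cast hle
    have hlin : (0 : ℚ) ≤ 2 * 8855 * (q : ℚ) + 421636 := by linarith
    nlinarith [mul_nonneg (mul_nonneg (sub_nonneg.2 hx4) (sub_nonneg.2 hQ)) hlin, hT, hx4, hQ]
  · have hQ : (719 : ℚ) ≤ (q : ℚ) := by exact_mod_cast (by omega : 719 ≤ q)
    have h1 : (719 : ℚ) * (q : ℚ) ≤ (q : ℚ) ^ 2 := by nlinarith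
    have h2 : (719 : ℚ) * (q : ℚ) ^ 2 ≤ (q : ℚ) ^ 3 := by nlinarith
    have h3 : (719 : ℚ) * (q : ℚ) ^ 3 ≤ (q : ℚ) ^ 4 := by nlinarith
    nlinarith [h1, h2, h3, hAt, hQ]

/-- `PolyIneq q 24` for every `q ≥ 4` (`A(24) = 16764240`, `C(24, 4) = 10626`; `A`-term alone for `q ≤ 3174`, `T`-term alone for `q ≥ 831`). -/
theorem polyIneq_twentyfour {q : ℕ} (hq : 4 ≤ q) : PolyIneq q 24 := by
  have hA : DGen.Aρt 24 4 2 = 16764240 := by decide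
  have hC : Nat.choose 24 4 = 10626 := by decide
  unfold PolyIneq
  rw [hA, hC]
  push_cast
  have hx4 : (4 : ℚ) ≤ (q : ℚ) := by exact_mod_cast hq
  have hnq : (0 : ℚ) ≤ 24 + (q : ℚ) - 4 := by linarith
  have hT : (0 : ℚ) ≤ (q : ℚ) * ((q : ℚ) + 1) ^ 2 * (24 + (q : ℚ) - 4) * (24 + 1) :=
    mul_nonneg (mul_nonneg (by positivity) hnq) (by norm_num)
  have hAt : (0 : ℚ) ≤ 2 * (2 * (q : ℚ) + 3) * (24 + (q : ℚ) - 4) * 16764240 :=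
    mul_nonneg (mul_nonneg (by linarith) hnq) (by norm_num)
  rcases le_or_gt q 3174 with hle | hlt
  · have hQ : (q : ℚ) ≤ 3174 := by exact_mod_cast hle
    have hlin : (0 : ℚ) ≤ 2 * 10626 * (q : ℚ) + 524400 := by linarith
    nlinarith [mul_nonneg (mul_nonneg (sub_nonneg.2 hx4) (sub_nonneg.2 hQ)) hlin, hT, hx4, hQ]
  · have hQ : (831 : ℚ) ≤ (q : ℚ) := by exact_mod_cast (by omega : 831 ≤ q)
    have h1 : (831 : ℚ) * (q : ℚ) ≤ (q : ℚ) ^ 2 := by nlinarith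
    have h2 : (831 : ℚ) * (q : ℚ) ^ 2 ≤ (q : ℚ) ^ 3 := by nlinarith
    have h3 : (831 : ℚ) * (q : ℚ) ^ 3 ≤ (q : ℚ) ^ 4 := by nlinarith
    nlinarith [h1, h2, h3, hAt, hQ]

/-- `PolyIneq q 25` for every `q ≥ 4` (`A(25) = 33539130`, `C(25, 4) = 12650`; `A`-term alone for `q ≤ 5323`, `T`-term alone for `q ≥ 953`). -/
theorem polyIneq_twentyfive {q : ℕ} (hq : 4 ≤ q) : PolyIneq q 25 := by
  have hA : DGen.Aρt 25 4 2 = 33539130 := by decide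
  have hC : Nat.choose 25 4 = 12650 := by decide
  unfold PolyIneq
  rw [hA, hC]
  push_cast
  have hx4 : (4 : ℚ) ≤ (q : ℚ) := by exact_mod_cast hq
  have hnq : (0 : ℚ) ≤ 25 + (q : ℚ) - 4 := by linarith
  have hT : (0 : ℚ) ≤ (q : ℚ) * ((q : ℚ) + 1) ^ 2 * (25 + (q : ℚ) - 4) * (25 + 1) :=
    mul_nonneg (mul_nonneg (by positivity) hnq) (by norm_num)
  have hAt : (0 : ℚ) ≤ 2 * (2 * (q : ℚ) + 3) * (25 + (q : ℚ) - 4) * 33539130 :=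
    mul_nonneg (mul_nonneg (by linarith) hnq) (by norm_num)
  rcases le_or_gt q 5323 with hle | hlt
  · have hQ : (q : ℚ) ≤ 5323 := by exact_mod_cast hle
    have hlin : (0 : ℚ) ≤ 2 * 12650 * (q : ℚ) + 667180 := by linarith
    nlinarith [mul_nonneg (mul_nonneg (sub_nonneg.2 hx4) (sub_nonneg.2 hQ)) hlin, hT, hx4, hQ]
  · have hQ : (953 : ℚ) ≤ (q : ℚ) := by exact_mod_cast (by omega : 953 ≤ q)
    have h1 : (953 : ℚ) * (q : ℚ) ≤ (q : ℚ) ^ 2 := by nlinarith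
    have h2 : (953 : ℚ) * (q : ℚ) ^ 2 ≤ (q : ℚ) ^ 3 := by nlinarith
    have h3 : (953 : ℚ) * (q : ℚ) ^ 3 ≤ (q : ℚ) ^ 4 := by nlinarith
    nlinarith [h1, h2, h3, hAt, hQ]

/-- `PolyIneq q 26` for every `q ≥ 4` (`A(26) = 67090935`, `C(26, 4) = 14950`; `A`-term alone for `q ≤ 8996`, `T`-term alone for `q ≥ 1086`). -/
theorem polyIneq_twentysix {q : ℕ} (hq : 4 ≤ q) : PolyIneq q 26 := by
  have hA : DGen.Aρt 26 4 2 = 67090935 := by decide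
  have hC : Nat.choose 26 4 = 14950 := by decide
  unfold PolyIneq
  rw [hA, hC]
  push_cast
  have hx4 : (4 : ℚ) ≤ (q : ℚ) := by exact_mod_cast hq
  have hnq : (0 : ℚ) ≤ 26 + (q : ℚ) - 4 := by linarith
  have hT : (0 : ℚ) ≤ (q : ℚ) * ((q : ℚ) + 1) ^ 2 * (26 + (q : ℚ) - 4) * (26 + 1) :=
    mul_nonneg (mul_nonneg (by positivity) hnq) (by norm_num)
  have hAt : (0 : ℚ) ≤ 2 * (2 * (q : ℚ) + 3) * (26 + (q : ℚ) - 4) * 67090935 :=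
    mul_nonneg (mul_nonneg (by linarith) hnq) (by norm_num)
  rcases le_or_gt q 8996 with hle | hlt
  · have hQ : (q : ℚ) ≤ 8996 := by exact_mod_cast hle
    have hlin : (0 : ℚ) ≤ 2 * 14950 * (q : ℚ) + 796060 := by linarith
    nlinarith [mul_nonneg (mul_nonneg (sub_nonneg.2 hx4) (sub_nonneg.2 hQ)) hlin, hT, hx4, hQ]
  · have hQ : (1086 : ℚ) ≤ (q : ℚ) := by exact_mod_cast (by omega : 1086 ≤ q)
    have h1 : (1086 : ℚ) * (q : ℚ) ≤ (q : ℚ) ^ 2 := by nlinarith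
    have h2 : (1086 : ℚ) * (q : ℚ) ^ 2 ≤ (q : ℚ) ^ 3 := by nlinarith
    have h3 : (1086 : ℚ) * (q : ℚ) ^ 3 ≤ (q : ℚ) ^ 4 := by nlinarith
    nlinarith [h1, h2, h3, hAt, hQ]

/-- `PolyIneq q 27` for every `q ≥ 4` (`A(27) = 134196846`, `C(27, 4) = 17550`; `A`-term alone for `q ≤ 15315`, `T`-term alone for `q ≥ 1231`). -/
theorem polyIneq_twentyseven {q : ℕ} (hq : 4 ≤ q) : PolyIneq q 27 := by
  have hA : DGen.Aρt 27 4 2 = 134196846 := by decide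
  have hC : Nat.choose 27 4 = 17550 := by decide
  unfold PolyIneq
  rw [hA, hC]
  push_cast
  have hx4 : (4 : ℚ) ≤ (q : ℚ) := by exact_mod_cast hq
  have hnq : (0 : ℚ) ≤ 27 + (q : ℚ) - 4 := by linarith
  have hT : (0 : ℚ) ≤ (q : ℚ) * ((q : ℚ) + 1) ^ 2 * (27 + (q : ℚ) - 4) * (27 + 1) :=
    mul_nonneg (mul_nonneg (by positivity) hnq) (by norm_num)
  have hAt : (0 : ℚ) ≤ 2 * (2 * (q : ℚ) + 3) * (27 + (q : ℚ) - 4) * 134196846 :=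
    mul_nonneg (mul_nonneg (by linarith) hnq) (by norm_num)
  rcases le_or_gt q 15315 with hle | hlt
  · have hQ : (q : ℚ) ≤ 15315 := by exact_mod_cast hle
    have hlin : (0 : ℚ) ≤ 2 * 17550 * (q : ℚ) + 979716 := by linarith
    nlinarith [mul_nonneg (mul_nonneg (sub_nonneg.2 hx4) (sub_nonneg.2 hQ)) hlin, hT, hx4, hQ]
  · have hQ : (1231 : ℚ) ≤ (q : ℚ) := by exact_mod_cast (by omega : 1231 ≤ q)
    have h1 : (1231 : ℚ) * (q : ℚ) ≤ (q : ℚ) ^ 2 := by nlinarith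
    have h2 : (1231 : ℚ) * (q : ℚ) ^ 2 ≤ (q : ℚ) ^ 3 := by nlinarith
    have h3 : (1231 : ℚ) * (q : ℚ) ^ 3 ≤ (q : ℚ) ^ 4 := by nlinarith
    nlinarith [h1, h2, h3, hAt, hQ]

/-- `PolyIneq q 28` for every `q ≥ 4` (`A(28) = 268411269`, `C(28, 4) = 20475`; `A`-term alone for `q ≤ 26241`, `T`-term alone for `q ≥ 1389`). -/
theorem polyIneq_twentyeight {q : ℕ} (hq : 4 ≤ q) : PolyIneq q 28 := by
  have hA : DGen.Aρt 28 4 2 = 268411269 := by decide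
  have hC : Nat.choose 28 4 = 20475 := by decide
  unfold PolyIneq
  rw [hA, hC]
  push_cast
  have hx4 : (4 : ℚ) ≤ (q : ℚ) := by exact_mod_cast hq
  have hnq : (0 : ℚ) ≤ 28 + (q : ℚ) - 4 := by linarith
  have hT : (0 : ℚ) ≤ (q : ℚ) * ((q : ℚ) + 1) ^ 2 * (28 + (q : ℚ) - 4) * (28 + 1) :=
    mul_nonneg (mul_nonneg (by positivity) hnq) (by norm_num)
  have hAt : (0 : ℚ) ≤ 2 * (2 * (q : ℚ) + 3) * (28 + (q : ℚ) - 4) * 268411269 :=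
    mul_nonneg (mul_nonneg (by linarith) hnq) (by norm_num)
  rcases le_or_gt q 26241 with hle | hlt
  · have hQ : (q : ℚ) ≤ 26241 := by exact_mod_cast hle
    have hlin : (0 : ℚ) ≤ 2 * 20475 * (q : ℚ) + 1169574 := by linarith
    nlinarith [mul_nonneg (mul_nonneg (sub_nonneg.2 hx4) (sub_nonneg.2 hQ)) hlin, hT, hx4, hQ]
  · have hQ : (1389 : ℚ) ≤ (q : ℚ) := by exact_mod_cast (by omega : 1389 ≤ q)
    have h1 : (1389 : ℚ) * (q : ℚ) ≤ (q : ℚ) ^ 2 := by nlinarith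
    have h2 : (1389 : ℚ) * (q : ℚ) ^ 2 ≤ (q : ℚ) ^ 3 := by nlinarith
    have h3 : (1389 : ℚ) * (q : ℚ) ^ 3 ≤ (q : ℚ) ^ 4 := by nlinarith
    nlinarith [h1, h2, h3, hAt, hQ]

/-- `PolyIneq q 29` for every `q ≥ 4` (`A(29) = 536843041`, `C(29, 4) = 23751`; `A`-term alone for `q ≤ 45230`, `T`-term alone for `q ≥ 1559`). -/
theorem polyIneq_twentynine {q : ℕ} (hq : 4 ≤ q) : PolyIneq q 29 := by
  have hA : DGen.Aρt 29 4 2 = 536843041 := by decide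
  have hC : Nat.choose 29 4 = 23751 := by decide
  unfold PolyIneq
  rw [hA, hC]
  push_cast
  have hx4 : (4 : ℚ) ≤ (q : ℚ) := by exact_mod_cast hq
  have hnq : (0 : ℚ) ≤ 29 + (q : ℚ) - 4 := by linarith
  have hT : (0 : ℚ) ≤ (q : ℚ) * ((q : ℚ) + 1) ^ 2 * (29 + (q : ℚ) - 4) * (29 + 1) :=
    mul_nonneg (mul_nonneg (by positivity) hnq) (by norm_num)
  have hAt : (0 : ℚ) ≤ 2 * (2 * (q : ℚ) + 3) * (29 + (q : ℚ) - 4) * 536843041 :=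
    mul_nonneg (mul_nonneg (by linarith) hnq) (by norm_num)
  rcases le_or_gt q 45230 with hle | hlt
  · have hQ : (q : ℚ) ≤ 45230 := by exact_mod_cast hle
    have hlin : (0 : ℚ) ≤ 2 * 23751 * (q : ℚ) + 1428308 := by linarith
    nlinarith [mul_nonneg (mul_nonneg (sub_nonneg.2 hx4) (sub_nonneg.2 hQ)) hlin, hT, hx4, hQ]
  · have hQ : (1559 : ℚ) ≤ (q : ℚ) := by exact_mod_cast (by omega : 1559 ≤ q)
    have h1 : (1559 : ℚ) * (q : ℚ) ≤ (q : ℚ) ^ 2 := by nlinarith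
    have h2 : (1559 : ℚ) * (q : ℚ) ^ 2 ≤ (q : ℚ) ^ 3 := by nlinarith
    have h3 : (1559 : ℚ) * (q : ℚ) ^ 3 ≤ (q : ℚ) ^ 4 := by nlinarith
    nlinarith [h1, h2, h3, hAt, hQ]

/-- `PolyIneq q 30` for every `q ≥ 4` (`A(30) = 1073709862`, `C(30, 4) = 27405`; `A`-term alone for `q ≤ 78384`, `T`-term alone for `q ≥ 1743`). -/
theorem polyIneq_thirty {q : ℕ} (hq : 4 ≤ q) : PolyIneq q 30 := by
  have hA : DGen.Aρt 30 4 2 = 1073709862 := by decide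
  have hC : Nat.choose 30 4 = 27405 := by decide
  unfold PolyIneq
  rw [hA, hC]
  push_cast
  have hx4 : (4 : ℚ) ≤ (q : ℚ) := by exact_mod_cast hq
  have hnq : (0 : ℚ) ≤ 30 + (q : ℚ) - 4 := by linarith
  have hT : (0 : ℚ) ≤ (q : ℚ) * ((q : ℚ) + 1) ^ 2 * (30 + (q : ℚ) - 4) * (30 + 1) :=
    mul_nonneg (mul_nonneg (by positivity) hnq) (by norm_num)
  have hAt : (0 : ℚ) ≤ 2 * (2 * (q : ℚ) + 3) * (30 + (q : ℚ) - 4) * 1073709862 :=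
    mul_nonneg (mul_nonneg (by linarith) hnq) (by norm_num)
  rcases le_or_gt q 78384 with hle | hlt
  · have hQ : (q : ℚ) ≤ 78384 := by exact_mod_cast hle
    have hlin : (0 : ℚ) ≤ 2 * 27405 * (q : ℚ) + 1716452 := by linarith
    nlinarith [mul_nonneg (mul_nonneg (sub_nonneg.2 hx4) (sub_nonneg.2 hQ)) hlin, hT, hx4, hQ]
  · have hQ : (1743 : ℚ) ≤ (q : ℚ) := by exact_mod_cast (by omega : 1743 ≤ q)
    have h1 : (1743 : ℚ) * (q : ℚ) ≤ (q : ℚ) ^ 2 := by nlinarith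
    have h2 : (1743 : ℚ) * (q : ℚ) ^ 2 ≤ (q : ℚ) ^ 3 := by nlinarith
    have h3 : (1743 : ℚ) * (q : ℚ) ^ 3 ≤ (q : ℚ) ^ 4 := by nlinarith
    nlinarith [h1, h2, h3, hAt, hQ]

/-- `PolyIneq q 31` for every `q ≥ 4` (`A(31) = 2147447159`, `C(31, 4) = 31465`; `A`-term alone for `q ≤ 136524`, `T`-term alone for `q ≥ 1940`). -/
theorem polyIneq_thirtyone {q : ℕ} (hq : 4 ≤ q) : PolyIneq q 31 := by
  have hA : DGen.Aρt 31 4 2 = 2147447159 := by decide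
  have hC : Nat.choose 31 4 = 31465 := by decide
  unfold PolyIneq
  rw [hA, hC]
  push_cast
  have hx4 : (4 : ℚ) ≤ (q : ℚ) := by exact_mod_cast hq
  have hnq : (0 : ℚ) ≤ 31 + (q : ℚ) - 4 := by linarith
  have hT : (0 : ℚ) ≤ (q : ℚ) * ((q : ℚ) + 1) ^ 2 * (31 + (q : ℚ) - 4) * (31 + 1) :=
    mul_nonneg (mul_nonneg (by positivity) hnq) (by norm_num)
  have hAt : (0 : ℚ) ≤ 2 * (2 * (q : ℚ) + 3) * (31 + (q : ℚ) - 4) * 2147447159 :=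
    mul_nonneg (mul_nonneg (by linarith) hnq) (by norm_num)
  rcases le_or_gt q 136524 with hle | hlt
  · have hQ : (q : ℚ) ≤ 136524 := by exact_mod_cast hle
    have hlin : (0 : ℚ) ≤ 2 * 31465 * (q : ℚ) + 2044264 := by linarith
    nlinarith [mul_nonneg (mul_nonneg (sub_nonneg.2 hx4) (sub_nonneg.2 hQ)) hlin, hT, hx4, hQ]
  · have hQ : (1940 : ℚ) ≤ (q : ℚ) := by exact_mod_cast (by omega : 1940 ≤ q)
    have h1 : (1940 : ℚ) * (q : ℚ) ≤ (q : ℚ) ^ 2 := by nlinarith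
    have h2 : (1940 : ℚ) * (q : ℚ) ^ 2 ≤ (q : ℚ) ^ 3 := by nlinarith
    have h3 : (1940 : ℚ) * (q : ℚ) ^ 3 ≤ (q : ℚ) ^ 4 := by nlinarith
    nlinarith [h1, h2, h3, hAt, hQ]

/-- `PolyIneq q 32` for every `q ≥ 4` (`A(32) = 4294925814`, `C(32, 4) = 35960`; `A`-term alone for `q ≤ 238899`, `T`-term alone for `q ≥ 2152`). -/
theorem polyIneq_thirtytwo {q : ℕ} (hq : 4 ≤ q) : PolyIneq q 32 := by
  have hA : DGen.Aρt 32 4 2 = 4294925814 := by decide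
  have hC : Nat.choose 32 4 = 35960 := by decide
  unfold PolyIneq
  rw [hA, hC]
  push_cast
  have hx4 : (4 : ℚ) ≤ (q : ℚ) := by exact_mod_cast hq
  have hnq : (0 : ℚ) ≤ 32 + (q : ℚ) - 4 := by linarith
  have hT : (0 : ℚ) ≤ (q : ℚ) * ((q : ℚ) + 1) ^ 2 * (32 + (q : ℚ) - 4) * (32 + 1) :=
    mul_nonneg (mul_nonneg (by positivity) hnq) (by norm_num)
  have hAt : (0 : ℚ) ≤ 2 * (2 * (q : ℚ) + 3) * (32 + (q : ℚ) - 4) * 4294925814 :=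
    mul_nonneg (mul_nonneg (by linarith) hnq) (by norm_num)
  rcases le_or_gt q 238899 with hle | hlt
  · have hQ : (q : ℚ) ≤ 238899 := by exact_mod_cast hle
    have hlin : (0 : ℚ) ≤ 2 * 35960 * (q : ℚ) + 2344344 := by linarith
    nlinarith [mul_nonneg (mul_nonneg (sub_nonneg.2 hx4) (sub_nonneg.2 hQ)) hlin, hT, hx4, hQ]
  · have hQ : (2152 : ℚ) ≤ (q : ℚ) := by exact_mod_cast (by omega : 2152 ≤ q)
    have h1 : (2152 : ℚ) * (q : ℚ) ≤ (q : ℚ) ^ 2 := by nlinarith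
    have h2 : (2152 : ℚ) * (q : ℚ) ^ 2 ≤ (q : ℚ) ^ 3 := by nlinarith
    have h3 : (2152 : ℚ) * (q : ℚ) ^ 3 ≤ (q : ℚ) ^ 4 := by nlinarith
    nlinarith [h1, h2, h3, hAt, hQ]

end PercRepro.Shadow

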